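import Mathlib
import Summits.Langlands.Langlands.Theorems.AbelianSurfaceSerreSerreGSp4SurjectiveSingerDefs
import HarnessLib

/-!
# Crux `SerreGSp4Surjective` (stmt-Langlands-17765), line `singer-type-evaporation`:
# stub `stub_irredOnCycKernel` — full symplectic image ⇒ irreducible on `Γ_{ℚ(ζ_p)}`

Registered signature, proved VERBATIM below: for `p ≥ 3` and `ρ̄ : Γ_ℚ → GL₄(𝔽_p)` with (H1)
`FullSymplecticImage p ρ̄` (`ρ̄` preserves some `J`, `Jᵀ = -J`, `det J` a unit, up to the multiplier
`ε̄_p(g)⁻¹`, and every `M` with `Mᵀ J M = c • J`, `c` a unit, is in the image), the base change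
`ρ̄ ⊗ 𝔽̄_p` restricted to `ker ε̄_p = Γ_{ℚ(ζ_p)}` is irreducible (`IrredOnCycKernel p ρ̄`, Mathlib
`Representation.IsIrreducible` = the subrepresentations form a simple order).

Proof (elementary group theory, no named fact):
1. For every `v ∈ 𝔽_p⁴` the symplectic transvection `T_v = 1 + v (vᵀ J)` (`x ↦ x + (vᵀ J x) v`)
   satisfies `T_vᵀ J T_v = J` (`sympTransvection_transpose_mul_mul`; uses `Jᵀ = -J` and `2 ≠ 0`
   in `𝔽_p`, whence `vᵀ J v = 0` — this is where `3 ≤ p` enters; at `p = 2` the statement is false).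
2. Any `M` with `Mᵀ J M = J` is invertible (`det M ^ 2 = 1`), so by (H1) `M = ρ̄(g)` for some `g`;
   comparing `ρ̄(g)ᵀ J ρ̄(g) = ε̄_p(g)⁻¹ • J` with `= J ≠ 0` gives `ε̄_p(g) = 1`, i.e. `g ∈ ker ε̄_p`
   (`exists_mem_ker_val_eq`).  So every `T_v ⊗ 𝔽̄_p` acts on every subrepresentation `W`.
3. `T_v x - x = (vᵀ J x) v`, so a `W` stable under all `T_v` contains `v ⊗ 1` as soon as
   `vᵀ J x ≠ 0` for some `x ∈ W`.  If `W ∋ x ≠ 0` then `J x ≠ 0` gives a standard vector `e_i ∈ W`;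
   a non-zero entry `J m i` of the `i`-th column gives `e_m ∈ W` and then every `e_j ∈ W`
   (directly if `J j i ≠ 0`, via `e_j + e_m ∈ W` otherwise), so `W = ⊤`
   (`submodule_eq_bot_or_eq_top_of_sympTransvection_stable`).

References: E. Artin, *Geometric Algebra* (1957), Ch. III §5 and Thm 3.25 (symplectic transvections
generate `Sp` and act irreducibly); Barnet-Lamb–Gee–Geraghty–Taylor, *Potential automorphy and
change of weight* (2014), Thm 4.2.1 (the consumer of the residual irreducibility).
-/

set_option linter.dupNamespace false -- `Summit.Langlands.Langlands` is the mandated namespace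

namespace Summit.Langlands.Langlands.Cruxes.SerreGSp4Surjective.SingerTypeEvaporation

open Literature.NumberTheory.GaloisRepresentations Literature.NumberTheory.Automorphic
open Matrix

noncomputable section

/-! ## Symplectic transvections (matrix algebra over a commutative ring) -/

section Transvection

variable {ι F : Type*} [Fintype ι] [DecidableEq ι] [CommRing F]

/-- The **symplectic transvection** `T_v = 1 + v (vᵀ J)` of the vector `v` for the bilinear form
with Gram matrix `J` (the matrix of `x ↦ x + (vᵀ J x) v`, Mathlib `Matrix.vecMulVec v (v ᵥ* J)`)
preserves an alternating form: if `Jᵀ = -J` and `2 a = 0 ⇒ a = 0` in `F` (so that `vᵀ J v = 0`),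
then `T_vᵀ J T_v = J`. [folklore] -/
theorem sympTransvection_transpose_mul_mul (J : Matrix ι ι F) (hJ : Jᵀ = -J)
    (h2 : ∀ a : F, 2 * a = 0 → a = 0) (v : ι → F) :
    (1 + vecMulVec v (v ᵥ* J))ᵀ * J * (1 + vecMulVec v (v ᵥ* J)) = J := by
  set u : ι → F := v ᵥ* J with hu
  have hJv : J *ᵥ v = -u := by
    rw [hu, ← mulVec_transpose, hJ, neg_mulVec, neg_neg]
  have huv : u ⬝ᵥ v = 0 := by
    apply h2
    have h : u ⬝ᵥ v = -(u ⬝ᵥ v) := by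
      conv_lhs => rw [hu, ← dotProduct_mulVec, hJv, dotProduct_neg, dotProduct_comm]
    rw [two_mul]
    nth_rewrite 1 [h]
    exact neg_add_cancel _
  have hT : (1 + vecMulVec v u)ᵀ = 1 + vecMulVec u v := by
    rw [transpose_add, transpose_one, transpose_vecMulVec]
  have h1 : (1 + vecMulVec u v) * J = J + vecMulVec u u := by
    rw [add_mul, Matrix.one_mul, vecMulVec_mul]
  have h2' : (J + vecMulVec u u) * (1 + vecMulVec v u) = J := by
    rw [mul_add, Matrix.mul_one, add_mul, mul_vecMulVec, hJv, neg_vecMulVec,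
      vecMulVec_mul_vecMulVec, huv, zero_smul, vecMulVec_zero, add_zero, add_neg_cancel_right]
  rw [hT, h1, h2']

/-- A matrix preserving a form whose Gram matrix has unit determinant (`Mᵀ J M = J`) is
invertible: `det M ^ 2 = 1`. [folklore] -/
theorem isUnit_of_transpose_mul_mul_eq {M J : Matrix ι ι F} (hJ : IsUnit J.det)
    (hM : Mᵀ * J * M = J) : IsUnit M := by
  rw [isUnit_iff_isUnit_det]
  have h := congrArg det hM
  rw [det_mul, det_mul, det_transpose, mul_right_comm] at h
  exact IsUnit.of_mul_eq_one _ (hJ.mul_eq_right.mp h)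

/-- The base change of the symplectic transvection `T_v = 1 + v (vᵀ J)` along `f : F →+* k` acts
on `k^ι` by `x ↦ x + (vᵀ J x) v`. [folklore] -/
theorem sympTransvection_map_mulVec {k : Type*} [CommRing k] (f : F →+* k) (J : Matrix ι ι F)
    (v : ι → F) (x : ι → k) :
    ((1 + vecMulVec v (v ᵥ* J)).map f) *ᵥ x = x + ((f ∘ (v ᵥ* J)) ⬝ᵥ x) • (f ∘ v) := by
  have hmap : (1 + vecMulVec v (v ᵥ* J)).map f = 1 + vecMulVec (f ∘ v) (f ∘ (v ᵥ* J)) := by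
    rw [Matrix.map_add f (map_add f), Matrix.map_one f (map_zero f) (map_one f)]
    congr 1
    ext i j
    simp [vecMulVec_apply]
  rw [hmap, add_mulVec, one_mulVec, vecMulVec_mulVec, op_smul_eq_smul]

end Transvection

/-! ## A subspace stable under all rational symplectic transvections is trivial -/

section Irreducible

variable {ι F k : Type*} [Fintype ι] [DecidableEq ι] [Field F] [Field k]

/-- **Irreducibility of `Sp(J)(F)` on `k^ι` via transvections.**  Let `f : F →+* k` be a field
embedding, `J` a Gram matrix over `F` with unit determinant, and `W ≤ k^ι` a subspace stable under
the base changes of all `F`-rational transvections `T_v = 1 + v (vᵀ J)`, `v ∈ F^ι`.  Then `W = ⊥`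
or `W = ⊤`: `T_v x - x = (vᵀ J x) v`, so `W ≠ ⊥` contains a standard vector `e_i` (`J x ≠ 0`),
then `e_m` for a non-zero entry `J m i` of the `i`-th column, then every `e_j`. [folklore] -/
theorem submodule_eq_bot_or_eq_top_of_sympTransvection_stable (f : F →+* k) (J : Matrix ι ι F)
    (hJdet : IsUnit J.det) (W : Submodule k (ι → k))
    (hW : ∀ v : ι → F, ∀ x ∈ W, ((1 + vecMulVec v (v ᵥ* J)).map f) *ᵥ x ∈ W) :
    W = ⊥ ∨ W = ⊤ := by
  classical
  -- the key consequence of stability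
  have hkey : ∀ (v : ι → F), ∀ x ∈ W, (f ∘ (v ᵥ* J)) ⬝ᵥ x ≠ 0 → (f ∘ v) ∈ W := by
    intro v x hx hne
    have h1 : ((f ∘ (v ᵥ* J)) ⬝ᵥ x) • (f ∘ v) ∈ W := by
      have := W.sub_mem (hW v x hx) hx
      rwa [sympTransvection_map_mulVec, add_sub_cancel_left] at this
    rwa [W.smul_mem_iff hne] at h1
  have hfsingle : ∀ j : ι, f ∘ (Pi.single j (1 : F)) = Pi.single j (1 : k) := by
    intro j
    ext l
    rcases eq_or_ne l j with rfl | h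
    · simp
    · simp [h]
  rcases eq_or_ne W ⊥ with hbot | hbot
  · exact Or.inl hbot
  right
  obtain ⟨x, hxW, hx0⟩ := Submodule.exists_mem_ne_zero_of_ne_bot hbot
  -- `J ⊗ k` is non-singular, so `J x ≠ 0`
  have hJf : (J.map f).det ≠ 0 := by
    rw [← RingHom.mapMatrix_apply, ← RingHom.map_det]
    exact (hJdet.map _).ne_zero
  have hJx : (J.map f) *ᵥ x ≠ 0 := fun h => hx0 (eq_zero_of_mulVec_eq_zero hJf h)
  obtain ⟨i, hi⟩ := Function.ne_iff.mp hJx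
  -- hence `e_i ∈ W`
  have hei : (Pi.single i (1 : k) : ι → k) ∈ W := by
    rw [← hfsingle]
    refine hkey (Pi.single i 1) x hxW ?_
    rw [single_one_vecMul]
    exact hi
  -- the `i`-th column of `J` has a non-zero entry `J m i`
  obtain ⟨m, hm⟩ : ∃ m, J m i ≠ 0 := by
    by_contra h
    push Not at h
    exact hJdet.ne_zero (det_eq_zero_of_column_eq_zero i h)
  -- every `F`-rational `v` pairing non-trivially with `e_i` lies in `W`
  have hkey' : ∀ v : ι → F, (v ᵥ* J) i ≠ 0 → (f ∘ v) ∈ W := by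
    intro v hv
    refine hkey v _ hei ?_
    rw [dotProduct_single, mul_one]
    exact (map_ne_zero f).mpr hv
  have hem : (Pi.single m (1 : k) : ι → k) ∈ W := by
    rw [← hfsingle]
    exact hkey' _ (by rw [single_one_vecMul]; exact hm)
  have hall : ∀ j : ι, (Pi.single j (1 : k) : ι → k) ∈ W := by
    intro j
    by_cases hj : J j i = 0
    · have h1 : f ∘ (Pi.single j (1 : F) + Pi.single m 1) ∈ W := by
        refine hkey' _ ?_
        rw [add_vecMul, Pi.add_apply, single_one_vecMul, single_one_vecMul]
        change J j i + J m i ≠ 0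
        rwa [hj, zero_add]
      have h2 : f ∘ (Pi.single j (1 : F) + Pi.single m 1) =
          Pi.single j (1 : k) + Pi.single m (1 : k) := by
        rw [← hfsingle j, ← hfsingle m]
        ext l
        simp
      rw [h2] at h1
      simpa using W.sub_mem h1 hem
    · rw [← hfsingle]
      exact hkey' _ (by rw [single_one_vecMul]; exact hj)
  -- so `W = ⊤`
  rw [eq_top_iff, ← (Pi.basisFun k ι).span_eq, Submodule.span_le]
  rintro _ ⟨j, rfl⟩
  simpa only [Pi.basisFun_apply, SetLike.mem_coe] using hall j

end Irreducible

/-! ## The stub -/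

section Stub

variable {p : ℕ} [Fact p.Prime]

/-- Under the multiplier and surjectivity clauses of (H1), every `M` with `Mᵀ J M = J` is `ρ̄(g)`
for some `g ∈ ker ε̄_p`: `M` is invertible, so `M = ρ̄(g)` by surjectivity (with `c = 1`), and then
`J = ε̄_p(g)⁻¹ • J` with `J ≠ 0` forces `ε̄_p(g) = 1`. [folklore] -/
theorem exists_mem_ker_val_eq (ρ : FramedGaloisRep ℚ (ZMod p) 4)
    {J : Matrix (Fin 4) (Fin 4) (ZMod p)} (hJdet : IsUnit J.det)
    (hmult : ∀ g : Field.absoluteGaloisGroup ℚ, (ρ g).val.transpose * J * (ρ g).val =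
      (((modPCyclotomicCharacterZMod ℚ p g)⁻¹ : (ZMod p)ˣ) : ZMod p) • J)
    (hsurj : ∀ M : GL (Fin 4) (ZMod p),
      (∃ c : ZMod p, IsUnit c ∧ M.val.transpose * J * M.val = c • J) → M ∈ ρ.toMonoidHom.range)
    {M : Matrix (Fin 4) (Fin 4) (ZMod p)} (hM : Mᵀ * J * M = J) :
    ∃ g ∈ (modPCyclotomicCharacterZMod ℚ p).ker, (ρ g).val = M := by
  have hMu : IsUnit M := isUnit_of_transpose_mul_mul_eq hJdet hM
  obtain ⟨g, hg⟩ := hsurj hMu.unit ⟨1, isUnit_one, by rw [hMu.unit_spec, one_smul]; exact hM⟩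
  have hgM : (ρ g).val = M := by
    have h := congrArg (fun u : GL (Fin 4) (ZMod p) => (u : Matrix (Fin 4) (Fin 4) (ZMod p))) hg
    rw [hMu.unit_spec] at h
    exact h
  refine ⟨g, ?_, hgM⟩
  -- `J ≠ 0`
  have hJ0 : J ≠ 0 := by
    rintro rfl
    rw [det_zero] at hJdet
    exact not_isUnit_zero hJdet
  obtain ⟨i, hi⟩ := Function.ne_iff.mp hJ0
  obtain ⟨j, hij⟩ := Function.ne_iff.mp hi
  have hij' : J i j ≠ 0 := hij
  have h1 := hmult g
  rw [hgM, hM] at h1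
  have h2 := congr_fun (congr_fun h1 i) j
  rw [Matrix.smul_apply, smul_eq_mul] at h2
  have hc : (((modPCyclotomicCharacterZMod ℚ p g)⁻¹ : (ZMod p)ˣ) : ZMod p) = 1 :=
    (mul_eq_right₀ hij').mp h2.symm
  rw [MonoidHom.mem_ker]
  rwa [Units.val_eq_one, inv_eq_one] at hc

/-- **Stub `stub_irredOnCycKernel` (registered signature, verbatim).**  For `p ≥ 3`, (H1)
`FullSymplecticImage p ρ̄` implies that `ρ̄ ⊗ 𝔽̄_p` restricted to `ker ε̄_p = Γ_{ℚ(ζ_p)}` is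
irreducible: the restriction contains (the base changes of) all symplectic transvections
`T_v`, `v ∈ 𝔽_p⁴` (`exists_mem_ker_val_eq`, `sympTransvection_transpose_mul_mul` — `p` odd makes
`J` alternating), and a subspace of `𝔽̄_p⁴` stable under all of them is `⊥` or `⊤`
(`submodule_eq_bot_or_eq_top_of_sympTransvection_stable`). [folklore] -/
theorem stub_irredOnCycKernel :
    ∀ (p : ℕ) [Fact p.Prime] (ρ : FramedGaloisRep ℚ (ZMod p) 4), 3 ≤ p →
      FullSymplecticImage p ρ → IrredOnCycKernel p ρ := by
  intro p _ ρ hp hH1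
  obtain ⟨J, hJt, hJdet, hmult, hsurj⟩ := hH1
  -- `2 ≠ 0` in `𝔽_p` since `p ≥ 3`
  have h2 : (2 : ZMod p) ≠ 0 := by
    intro h
    have h' : ((2 : ℕ) : ZMod p) = 0 := by exact_mod_cast h
    rw [ZMod.natCast_eq_zero_iff] at h'
    have := Nat.le_of_dvd two_pos h'
    omega
  have h2' : ∀ a : ZMod p, 2 * a = 0 → a = 0 := fun a ha => (mul_eq_zero.mp ha).resolve_left h2
  unfold IrredOnCycKernel
  set k := AlgebraicClosure (ZMod p)
  set f : ZMod p →+* k := algebraMap (ZMod p) k with hf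
  set σ : Representation k (modPCyclotomicCharacterZMod ℚ p).ker (Fin 4 → k) :=
    ((FramedRep.baseChangeRepresentation f ρ).comp
      (modPCyclotomicCharacterZMod ℚ p).ker.subtype) with hσ
  have hσapply : ∀ (g : (modPCyclotomicCharacterZMod ℚ p).ker) (x : Fin 4 → k),
      σ g x = ((ρ (g : Field.absoluteGaloisGroup ℚ)).val.map f) *ᵥ x := fun g x => rfl
  -- the subrepresentations of `σ` form a simple order
  have hbt : (⊥ : Subrepresentation σ) ≠ ⊤ := by
    intro h
    have h' : (⊥ : Submodule k (Fin 4 → k)) = ⊤ := congrArg Subrepresentation.toSubmodule h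
    exact bot_ne_top h'
  refine { toNontrivial := ⟨⟨⊥, ⊤, hbt⟩⟩, eq_bot_or_eq_top := fun W ↦ ?_ }
  have hW : ∀ v : Fin 4 → ZMod p, ∀ x ∈ W.toSubmodule,
      ((1 + vecMulVec v (v ᵥ* J)).map f) *ᵥ x ∈ W.toSubmodule := by
    intro v x hx
    obtain ⟨g, hgker, hgM⟩ := exists_mem_ker_val_eq ρ hJdet hmult hsurj
      (sympTransvection_transpose_mul_mul J hJt h2' v)
    have h := W.apply_mem_toSubmodule ⟨g, hgker⟩ hx
    rwa [hσapply, Subgroup.coe_mk, hgM] at h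
  rcases submodule_eq_bot_or_eq_top_of_sympTransvection_stable f J hJdet W.toSubmodule hW with
    h | h
  · exact Or.inl (Subrepresentation.toSubmodule_injective h)
  · exact Or.inr (Subrepresentation.toSubmodule_injective h)

end Stub

end

end Summit.Langlands.Langlands.Cruxes.SerreGSp4Surjective.SingerTypeEvaporation
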